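import Summits.ABC.IUTFork.Repair.BarrierNaive
import Summits.ABC.IUTFork.Cor312PinnedGapNotNecessary
import HarnessLib

/-!
# IUT REPAIR branch (A2.RP), BARRIER track, IX: the SCALE DICHOTOMY (pin it, or lose Step (x)), and the exponent family

Proof-only sequel (D-0012; no definition, no `Prop` fact) of `Repair/Barrier` (p428000) and `Repair/BarrierNaive` (p428451), seat abc-iut-rp-bar.
TAKES NO SIDE on [IUTchIII] Cor. 3.12 or between authors; typed ≠ proved.

§1 **THE SCALE DICHOTOMY** (`volumeChanging_not_mem_indGroup_of_stepX`, `scale_dichotomy`): over ANY data (a)(b)(c) `D` of a vertical line, a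
packet-automorphism family `Λ` that CHANGES the log-volume of some admissible region is EITHER outside the indeterminacy subgroup `⟨(Ind1) ∪ (Ind2)⟩`
— then it is a SCALE in the sense of the barrier: a repair must pin it (BAR-V `VolumePinned`) and a scale-blind candidate cannot see it (BAR-Q(b)) —
OR inside it, and then Step (x) of the proof of Cor. 3.12 (generator-level admissibility transport + `MRData.LogvolInvariant`, [IUTchIII] p. 181 l. 2–5)
FAILS for `D` (abc-iut-L6-t13's closure propagation `adm_and_logvol_eq_of_mem_closure`, contraposed). This is the abstract form, at the level of the
frozen interface, of the alternative the branch's B5 files price model by model: abc-iut-rp-s2's «door (O3)» `rescaling_door` (transport made an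
indeterminacy ⊢ S ∧ ¬ThetaFinite, `ObstructionSS2` p428259) and abc-iut-w4-d098's `ScalarShells` (p429955: `Ism ∋ p`). In words (neutral): the factor
`(j² − 1)·ord(q)` is paid either as a POSITED DATUM across the link or as the LOSS of Step (x) / of «−|log(Θ)| ∈ ℝ»; the kernel does not say which,
and neither option is attributed to any author here.
§2 **The exponent family** (abc-iut-w5-d232's `expSetting p e := withQDatum p (qDatumExp e)`, `Cor312PinnedGapNotNecessary` p420347: residual ⟺
`e = (1,4)`): `not_holds_expSetting` — a scale-blind sufficient candidate is false at every exponent vector with a positive entry (REPAIR-SPEC §6 BAR-2's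
«exponent-family twin», covered verbatim by `Repair.NaiveFamily.not_holds_withQDatum`). [claim: Mochizuki2012, status: disputed]
[cite: ScholzeStix2018, §2.2 pp. 9–10]
-/

noncomputable section

open Set

namespace Summit.ABC.IUTFork.Repair

open Thm311 Cor312 Cor312Vol Literature.IUT.LogThetaLattice Cor312.Checks Cor312.IdentifiedNonVacuity
open Cor312Vol.GluedMonoids.Naive Cor312Vol.PinnedWitness Cor312Vol.NaiveWitness

/-! ## 1. The scale dichotomy over the frozen interface -/

section Dichotomy

variable {T : ThetaIndex} {L : LogShells T} (D : MRData L)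

/-- **Under Step (x), an indeterminacy cannot change the volume of an admissible region** (abc-iut-L6-t13's
`MRData.adm_and_logvol_eq_of_mem_closure`, restated as the barrier uses it). [claim: Mochizuki2012, status: disputed] -/
theorem logvol_image_eq_of_mem_indGroup_of_stepX
    (hAdm : ∀ Φ ∈ L.Ind1Family ∪ L.Ind2Family, ∀ j vQ (B : Set (L.Packet j vQ)), D.Adm j vQ B ↔ D.Adm j vQ (Φ j vQ '' B))
    (hvol : D.LogvolInvariant) {Λ : L.PacketAut} (hΛ : Λ ∈ Subgroup.closure (L.Ind1Family ∪ L.Ind2Family))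
    (j : T.Label) (vQ : T.VQ) (A : Set (L.Packet j vQ)) (hA : D.Adm j vQ A) :
    D.logvol j vQ (Λ j vQ '' A) = D.logvol j vQ A :=
  (D.adm_and_logvol_eq_of_mem_closure hAdm hvol hΛ j vQ A hA).2

/-- **A volume-changing family is NOT an indeterminacy, given Step (x).** [folklore] -/
theorem volumeChanging_not_mem_indGroup_of_stepX
    (hAdm : ∀ Φ ∈ L.Ind1Family ∪ L.Ind2Family, ∀ j vQ (B : Set (L.Packet j vQ)), D.Adm j vQ B ↔ D.Adm j vQ (Φ j vQ '' B))
    (hvol : D.LogvolInvariant) {Λ : L.PacketAut} {j : T.Label} {vQ : T.VQ} {A : Set (L.Packet j vQ)} (hA : D.Adm j vQ A)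
    (hne : D.logvol j vQ (Λ j vQ '' A) ≠ D.logvol j vQ A) :
    Λ ∉ Subgroup.closure (L.Ind1Family ∪ L.Ind2Family) := fun hΛ =>
  hne (logvol_image_eq_of_mem_indGroup_of_stepX D hAdm hvol hΛ j vQ A hA)

/-- **THE SCALE DICHOTOMY.** For every packet-automorphism family `Λ` changing the log-volume of some admissible region of the data `D`: EITHER
`Λ` lies OUTSIDE `⟨(Ind1) ∪ (Ind2)⟩` (a scale the indeterminacies do not absorb — what BAR-V says a repair must pin and BAR-Q(b) says a scale-blind
candidate cannot see), OR Step (x) fails for `D` (admissibility transport and generator-level volume invariance cannot both hold — the price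
abc-iut-rp-s2's `rescaling_door` / abc-iut-w4-d098's `ScalarShells` exhibit model by model). [claim: Mochizuki2012, status: disputed] -/
theorem scale_dichotomy {Λ : L.PacketAut} {j : T.Label} {vQ : T.VQ} {A : Set (L.Packet j vQ)} (hA : D.Adm j vQ A)
    (hne : D.logvol j vQ (Λ j vQ '' A) ≠ D.logvol j vQ A) :
    Λ ∉ Subgroup.closure (L.Ind1Family ∪ L.Ind2Family) ∨
      ¬ ((∀ Φ ∈ L.Ind1Family ∪ L.Ind2Family, ∀ j vQ (B : Set (L.Packet j vQ)), D.Adm j vQ B ↔ D.Adm j vQ (Φ j vQ '' B)) ∧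
          D.LogvolInvariant) := by
  by_cases h : (∀ Φ ∈ L.Ind1Family ∪ L.Ind2Family, ∀ j vQ (B : Set (L.Packet j vQ)), D.Adm j vQ B ↔ D.Adm j vQ (Φ j vQ '' B)) ∧
      D.LogvolInvariant
  · exact Or.inl (volumeChanging_not_mem_indGroup_of_stepX D h.1 h.2 hA hne)
  · exact Or.inr h

/-- The dichotomy read at a q-side move of a pinned setting: if the move `Λ` changes the q-volume in some packet (the `hne` of
`Repair.not_holds_of_qScaleInvariant`) then, the q-region being admissible (a hull-set), `Λ` is not an indeterminacy unless Step (x) fails for the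
column. [folklore] -/
theorem qMove_not_mem_indGroup_of_stepX {S : LatticeSituation T} (P : Setting S.toSituation)
    (hAdm : ∀ Φ ∈ S.L.Ind1Family ∪ S.L.Ind2Family, ∀ j vQ (B : Set (S.L.Packet j vQ)),
      (S.D P.n).Adm j vQ B ↔ (S.D P.n).Adm j vQ (Φ j vQ '' B))
    (hvol : (S.D P.n).LogvolInvariant) {Λ : S.L.PacketAut} {j : T.Label} {vQ : T.VQ}
    (hne : (S.D P.n).logvol j vQ (Λ j vQ '' P.qRegion j vQ) ≠ (S.D P.n).logvol j vQ (P.qRegion j vQ)) :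
    Λ ∉ Setting.indGroup S.toSituation :=
  volumeChanging_not_mem_indGroup_of_stepX (S.D P.n) hAdm hvol (P.qRegion_adm j vQ) hne

end Dichotomy

/-! ## 2. The exponent family is covered -/

section ExpFamily

variable {H : ∀ (T : ThetaIndex) (F : FullSituation T) (P : Setting F.toLatticeSituation.toSituation)
    (_ρ : (∀ v : T.V, v ∈ T.Vbad → Set (F.L.StarPacket v)) → ∀ (j : T.Label) (vQ : T.VQ), Set (F.L.Packet j vQ))
    (_qK : ∀ v : T.V, v ∈ T.Vbad → Set (F.L.StarPacket v)), Prop}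

variable (p : ℕ) [hp : Fact p.Prime]

/-- **BAR-2's exponent-family twin**: at abc-iut-w5-d232's `expSetting p e` (q-datum `{(±p^{e_j})_j}`; residual ⟺ `e = (1,4)`, p420347) a scale-blind
sufficient candidate is FALSE for every exponent vector with a positive entry — whatever the residual's truth value there. [folklore] -/
theorem not_holds_expSetting (hinv : QScaleInvariant H) (hsuf : Sufficient H) (e : toyIndex.LabelStar → ℕ) (he : 0 < esum e) :
    ¬ H toyIndex (naiveFull p) (expSetting p e) (ballOfMonoid p) fun v _ => qDatumExp p e v :=
  NaiveFamily.not_holds_withQDatum p hinv hsuf (fun v _ => qDatumExp p e v) (qDatumExp_hul p e) (expSetting_absLogQPos p e he)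

end ExpFamily

end Summit.ABC.IUTFork.Repair

end
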